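import Literature.ModelTheory.ExponentialFields.SemialgebraicInterior
import Literature.NumberTheory.Transcendental.SemialgebraicVolume
import Summits.KontsevichZagierPeriods.KontsevichZagierPeriods.Theorems.SoloInformedAlgebraicParameterTransfer
import Summits.KontsevichZagierPeriods.KontsevichZagierPeriods.Theorems.SoloInformedTameMapSlackValid
import Summits.KontsevichZagierPeriods.KontsevichZagierPeriods.Theorems.SoloInformedTameMapVolume
import HarnessLib

/-!
# Tame dissections up to sets of empty interior — soundness

For a nonlinear tame shape `σ : SoloInformedTameMapShape K n N` with `ℚ`-semialgebraic families of
pieces and graphs, a `ℚ`-semialgebraic source `D₀ ⊆ ℝⁿ` and a SLACK-valid real parameter `p`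
(`σ.SlackValid D₀ p`, file `SoloInformedTameMapSlackValid`: pieces inside `D₀` overlapping and
missing only sets of empty interior, images inside the box likewise, injective maps with
within-piece derivatives of determinant `±1`), the volume identity holds:
`volume D₀ = ENNReal.ofReal (∏_j a_j(p))` (`volume_eq_of_slackValid`), i.e.
`aeval p (∏_j Pa_j) = (volume D₀).toReal` (`aeval_prod_side_eq_volume_of_slackValid`).

Ingredients: (1) an `ℝ`-semialgebraic subset of `ℝᵐ` with empty interior is Lebesgue-null
(`soloInformed_volume_eq_zero_of_interior_eq_empty`, from the tree's
`IsSemialgebraic.subset_interior_union` and `volume_setOf_aeval_eq_zero`); (2) fibres of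
`ℚ`-semialgebraic families at real parameters are `ℝ`-semialgebraic
(`soloInformed_isSemialgebraic_real_fibre`), so every overlap / uncovered part named by slack
validity is null; (3) the change of variables of `SoloInformedTameMapVolume`
(`MeasureTheory.lintegral_abs_det_fderiv_eq_addHaar_image`) and `MeasureTheory.measure_iUnion₀`
for almost-disjoint unions.

References: [cite: BochnakCosteRoy1998, §2.2, §2.8]; [cite: EvansGariepy1992, §3.3].
-/

noncomputable section

open Set MeasureTheory MvPolynomial Literature.ModelTheory.ExponentialFields

namespace Summit.KontsevichZagierPeriods.KontsevichZagierPeriods.Theorems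

/-! ### Thin semialgebraic sets are null; fibres are `ℝ`-semialgebraic -/

/-- **A semialgebraic subset of `ℝᵐ` (coefficients in any `k`) with empty interior is
Lebesgue-null**: it lies in the zero set of finitely many nonzero polynomials.
[cite: BochnakCosteRoy1998, §2.8] -/
theorem soloInformed_volume_eq_zero_of_interior_eq_empty {k : Type*} [CommRing k] [Algebra k ℝ]
    {m : ℕ} {Z : Set (Fin m → ℝ)} (hZ : IsSemialgebraic k Z) (hint : interior Z = ∅) :
    volume Z = 0 := by
  obtain ⟨Q₀, hQ₀, hsub⟩ := hZ.subset_interior_union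
  rw [hint, empty_union] at hsub
  refine measure_mono_null hsub (le_antisymm ?_ bot_le)
  calc volume (⋃ q ∈ Q₀, {x : Fin m → ℝ | aeval x q = 0})
      ≤ ∑ q ∈ Q₀, volume {x : Fin m → ℝ | aeval x q = 0} := measure_biUnion_finset_le Q₀ _
    _ = 0 := Finset.sum_eq_zero fun q hq =>
        Literature.NumberTheory.Transcendental.volume_setOf_aeval_eq_zero q fun h0 => by
          obtain ⟨x, hx⟩ := hQ₀ q hq
          exact hx (by rw [aeval_def, ← eval_map, h0, map_zero])

/-- **Fibres of `ℚ`-semialgebraic families at real parameters are `ℝ`-semialgebraic** (the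
fibre is the preimage of the base-changed family under the polynomial map `x ↦ (p, x)`).
[cite: BochnakCosteRoy1998, §2.2] -/
theorem soloInformed_isSemialgebraic_real_fibre {K : Type*} {n : ℕ} {S : Set (K ⊕ Fin n → ℝ)}
    (hS : IsSemialgebraic ℚ S) (p : K → ℝ) :
    IsSemialgebraic ℝ {x : Fin n → ℝ | Sum.elim p x ∈ S} := by
  have h := (soloInformed_isSemialgebraic_baseChange ℝ hS).preimage_aeval
    (Sum.elim (fun l => C (p l)) (fun j => X j) : K ⊕ Fin n → MvPolynomial (Fin n) ℝ)
  convert h using 1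
  ext x
  have hx : (fun t => aeval x (Sum.elim (fun l => C (p l)) (fun j => X j) t :
      MvPolynomial (Fin n) ℝ)) = Sum.elim p x := by
    funext t
    rcases t with l | j
    · simp
    · simp only [Sum.elim_inr, aeval_X]
  simp only [mem_setOf_eq, mem_preimage, hx]

/-- The fibre of a `ℚ`-semialgebraic family with empty interior is null. [folklore] -/
theorem soloInformed_volume_fibre_eq_zero {K : Type*} {n : ℕ} {S : Set (K ⊕ Fin n → ℝ)}
    (hS : IsSemialgebraic ℚ S) {p : K → ℝ}
    (hint : interior {x : Fin n → ℝ | Sum.elim p x ∈ S} = ∅) :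
    volume {x : Fin n → ℝ | Sum.elim p x ∈ S} = 0 :=
  soloInformed_volume_eq_zero_of_interior_eq_empty (soloInformed_isSemialgebraic_real_fibre hS p)
    hint

namespace SoloInformedTameMapShape

variable {K : Type*} {n N : ℕ} (σ : SoloInformedTameMapShape K n N) {D₀ : Set (Fin n → ℝ)}
  {p : K → ℝ}

/-! ### The moving maps under slack validity -/

/-- Under slack validity, `move i p` is the function with graph `G i(p)` on piece `i`.
[folklore] -/
theorem rel_iff_move_eq_of_slack (hV : σ.SlackValid D₀ p) {i : Fin N} {x y : Fin n → ℝ}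
    (hx : x ∈ σ.piece i p) : σ.rel i p x y ↔ σ.move i p x = y := by
  obtain ⟨-, -, -, -, hex, huniq, -⟩ := σ.slackValid_iff.1 hV
  have hr : σ.rel i p x (σ.move i p x) := σ.rel_move (hex i x hx)
  exact ⟨fun h => huniq i x _ _ hx hr h, fun h => h ▸ hr⟩

/-- Under slack validity, the image `σ.img i p` is the image of piece `i` under `move i p`.
[folklore] -/
theorem img_eq_image_move_of_slack (hV : σ.SlackValid D₀ p) (i : Fin N) :
    σ.img i p = σ.move i p '' σ.piece i p := by
  ext y
  constructor
  · rintro ⟨x, hx, hr⟩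
    exact ⟨x, hx, (σ.rel_iff_move_eq_of_slack hV hx).1 hr⟩
  · rintro ⟨x, hx, rfl⟩
    exact ⟨x, hx, (σ.rel_iff_move_eq_of_slack hV hx).2 rfl⟩

/-- Under slack validity, `move i p` is injective on piece `i`. [folklore] -/
theorem injOn_move_of_slack (hV : σ.SlackValid D₀ p) (i : Fin N) :
    InjOn (σ.move i p) (σ.piece i p) := by
  intro x hx x' hx' hxx'
  obtain ⟨-, -, -, -, -, -, -, -, -, hinj, -⟩ := σ.slackValid_iff.1 hV
  exact hinj i x x' (σ.move i p x) hx hx' ((σ.rel_iff_move_eq_of_slack hV hx).2 rfl)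
    ((σ.rel_iff_move_eq_of_slack hV hx').2 hxx'.symm)

/-- Under slack validity, `move i p` has at every point of piece `i` a derivative WITHIN the
piece of determinant `±1`. [folklore] -/
theorem exists_hasFDerivWithinAt_move_of_slack (hV : σ.SlackValid D₀ p) (i : Fin N) :
    ∃ F : (Fin n → ℝ) → (Fin n → ℝ) →L[ℝ] (Fin n → ℝ),
      (∀ x ∈ σ.piece i p, HasFDerivWithinAt (σ.move i p) (F x) (σ.piece i p) x) ∧
      ∀ x ∈ σ.piece i p, |(F x).det| = 1 := by
  obtain ⟨-, -, -, -, -, -, -, -, -, -, hdiffOK⟩ := σ.slackValid_iff.1 hV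
  have hdiff := σ.diffOK_iff.1 (hdiffOK i)
  choose! ℓ hℓdet hℓT using hdiff
  refine ⟨fun x => soloInformedMatCLM (Matrix.of fun j k => ℓ x (j, k)), fun x hx => ?_,
    fun x hx => ?_⟩
  · apply soloInformed_hasFDerivWithinAt_of_taylor
    intro e he
    obtain ⟨d, hd, hT⟩ := hℓT x hx e he
    refine ⟨d, hd, fun x' hx' hcl j => ?_⟩
    have := hT x' (σ.move i p x) (σ.move i p x') hx' hcl
      ((σ.rel_iff_move_eq_of_slack hV hx).2 rfl) ((σ.rel_iff_move_eq_of_slack hV hx').2 rfl) j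
    simpa only [Matrix.of_apply] using this
  · rw [soloInformedMatCLM_det]
    exact soloInformed_abs_eq_one_of_sq_eq_one (hℓdet x hx)

/-- **Change of variables** under slack validity: `vol (σ.img i p) = vol (piece i)`.
[cite: EvansGariepy1992, §3.3] -/
theorem volume_img_of_slack {i : Fin N} (hS : IsSemialgebraic ℚ (σ.S i))
    (hV : σ.SlackValid D₀ p) : volume (σ.img i p) = volume (σ.piece i p) := by
  obtain ⟨F, hF, hdet⟩ := σ.exists_hasFDerivWithinAt_move_of_slack hV i
  have hmeas : MeasurableSet (σ.piece i p) := soloInformed_measurableSet_fibre hS p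
  rw [σ.img_eq_image_move_of_slack hV i,
    ← lintegral_abs_det_fderiv_eq_addHaar_image volume hmeas hF (σ.injOn_move_of_slack hV i)]
  have hEq : EqOn (fun x => ENNReal.ofReal |(F x).det|) (fun _ => 1) (σ.piece i p) :=
    fun x hx => by simp only [hdet x hx, ENNReal.ofReal_one]
  rw [setLIntegral_congr_fun hmeas hEq]
  exact setLIntegral_one _

/-- Under slack validity the image `σ.img i p` is measurable. [folklore] -/
theorem measurableSet_img_of_slack {i : Fin N} (hS : IsSemialgebraic ℚ (σ.S i))
    (hV : σ.SlackValid D₀ p) : MeasurableSet (σ.img i p) := by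
  obtain ⟨F, hF, -⟩ := σ.exists_hasFDerivWithinAt_move_of_slack hV i
  rw [σ.img_eq_image_move_of_slack hV i]
  exact measurable_image_of_fderivWithin (soloInformed_measurableSet_fibre hS p) hF
    (σ.injOn_move_of_slack hV i)

/-! ### The volume identity -/

/-- **SOUNDNESS, measure form, with slack**: `volume D₀ = ENNReal.ofReal (∏_j a_j(p))` for a
slack-valid parameter (overlaps and uncovered parts are `ℝ`-semialgebraic with empty interior,
hence null; almost-disjoint additivity; change of variables on each piece). [folklore] -/
theorem volume_eq_of_slackValid [Finite K] (hS : ∀ i, IsSemialgebraic ℚ (σ.S i))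
    (hG : ∀ i, IsSemialgebraic ℚ (σ.G i)) (hD₀ : IsSemialgebraic ℚ D₀)
    (hV : σ.SlackValid D₀ p) : volume D₀ = ENNReal.ofReal (∏ j, σ.side p j) := by
  obtain ⟨hside, hsub, hthin, hrest, hex, huniq, hinto, hthin', hrest', hinj, -⟩ :=
    σ.slackValid_iff.1 hV
  have hrel : ∀ i, ∀ x ∈ σ.piece i p, σ.rel i p x (σ.move i p x) := fun i x hx =>
    (σ.rel_iff_move_eq_of_slack hV hx).2 rfl
  have hmeas : ∀ i, MeasurableSet (σ.piece i p) := fun i =>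
    soloInformed_measurableSet_fibre (hS i) p
  have hmeas' : ∀ i, MeasurableSet (σ.img i p) := fun i => σ.measurableSet_img_of_slack (hS i) hV
  -- the uncovered part of the source is null
  have hU : (⋃ i, σ.piece i p) ⊆ D₀ := iUnion_subset fun i => hsub i
  have hrest0 : volume (D₀ \ ⋃ i, σ.piece i p) = 0 := by
    rw [← σ.setOf_sumElim_mem_restFam]
    refine soloInformed_volume_fibre_eq_zero (σ.isSemialgebraic_restFam hS hD₀) ?_
    rw [σ.setOf_sumElim_mem_restFam]
    exact hrest
  -- the pieces are almost disjoint
  have hAE : Pairwise (Function.onFun (AEDisjoint volume) fun i => σ.piece i p) := by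
    intro i i' hii'
    change volume (σ.piece i p ∩ σ.piece i' p) = 0
    rw [← σ.setOf_sumElim_mem_S_inter]
    refine soloInformed_volume_fibre_eq_zero ((hS i).inter (hS i')) ?_
    rw [σ.setOf_sumElim_mem_S_inter]
    exact hthin i i' hii'
  -- the images are almost disjoint
  have hAE' : Pairwise (Function.onFun (AEDisjoint volume) fun i => σ.img i p) := by
    intro i i' hii'
    change volume (σ.img i p ∩ σ.img i' p) = 0
    rw [← σ.setOf_sumElim_mem_imgFam_inter]
    refine soloInformed_volume_fibre_eq_zero
      ((σ.isSemialgebraic_imgFam (hS i) (hG i)).inter (σ.isSemialgebraic_imgFam (hS i') (hG i'))) ?_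
    rw [σ.setOf_sumElim_mem_imgFam_inter]
    exact hthin' i i' hii'
  -- the uncovered part of the box is null
  have hU' : (⋃ i, σ.img i p) ⊆ soloInformedTameBox (σ.side p) := by
    refine iUnion_subset fun i => ?_
    rintro y ⟨x, hx, hr⟩
    exact hinto i x y hx hr
  have hrest0' : volume (soloInformedTameBox (σ.side p) \ ⋃ i, σ.img i p) = 0 := by
    rw [← σ.setOf_sumElim_mem_imgRestFam]
    refine soloInformed_volume_fibre_eq_zero (σ.isSemialgebraic_imgRestFam hS hG) ?_
    rw [σ.setOf_sumElim_mem_imgRestFam]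
    exact hrest'
  have h1 : volume D₀ = ∑ i, volume (σ.piece i p) := by
    rw [← measure_eq_measure_of_null_sdiff hU hrest0,
      measure_iUnion₀ hAE fun i => (hmeas i).nullMeasurableSet, tsum_fintype]
  have h2 : volume (soloInformedTameBox (σ.side p)) = ∑ i, volume (σ.piece i p) := by
    rw [← measure_eq_measure_of_null_sdiff hU' hrest0',
      measure_iUnion₀ hAE' fun i => (hmeas' i).nullMeasurableSet, tsum_fintype]
    exact Finset.sum_congr rfl fun i _ => σ.volume_img_of_slack (hS i) hV
  have hbox : volume (soloInformedTameBox (σ.side p)) = ENNReal.ofReal (∏ j, σ.side p j) := by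
    rw [soloInformedTameBox, volume_pi_pi]
    simp only [Real.volume_Icc, sub_zero]
    rw [ENNReal.ofReal_prod_of_nonneg fun j _ => hside j]
  rw [h1, ← h2, hbox]

/-- **SOUNDNESS WITH SLACK.** If `p` is slack-valid for the nonlinear shape `σ` (with
`ℚ`-semialgebraic families of pieces and graphs) and the `ℚ`-semialgebraic source `D₀`, then the
rational polynomial `∏_j Pa_j` evaluates at `p` to `(volume D₀).toReal`. [folklore] -/
theorem aeval_prod_side_eq_volume_of_slackValid [Finite K] (hS : ∀ i, IsSemialgebraic ℚ (σ.S i))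
    (hG : ∀ i, IsSemialgebraic ℚ (σ.G i)) (hD₀ : IsSemialgebraic ℚ D₀)
    (hV : σ.SlackValid D₀ p) : aeval p (∏ j, σ.Pa j) = (volume D₀).toReal := by
  have hside : ∀ j, 0 ≤ σ.side p j := (σ.slackValid_iff.1 hV).1
  have hprod : aeval p (∏ j, σ.Pa j) = ∏ j, σ.side p j := by
    rw [map_prod]
    rfl
  rw [hprod, σ.volume_eq_of_slackValid hS hG hD₀ hV,
    ENNReal.toReal_ofReal (Finset.prod_nonneg fun j _ => hside j)]

end SoloInformedTameMapShape

end Summit.KontsevichZagierPeriods.KontsevichZagierPeriods.Theorems
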